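import Summits.NavierStokesRegularity.NavierStokesRegularity.Theses.AxisymmetricExtremality
import Summits.NavierStokesRegularity.NavierStokesRegularity.Theorems.AxisymmetricExtremalityAxisymmetricKatoGlobalStubAxisBoundedOfLocalEnergyOrigin
import Literature.Analysis.FluidPDE.Seregin2020AxisymmetricTypeII
import Literature.Analysis.FluidPDE.AxisymmetricTypeIBounded
import Literature.Analysis.FluidPDE.SuitableWeakRescaling
import Literature.Analysis.FluidPDE.ClassicalSuitable
import Literature.Analysis.FluidPDE.SereginSverakBlowupSelection
import HarnessLib

/-!
# Crux `AxisymmetricKatoGlobal` (stmt-NavierStokesRegularity-15453), line `euler-scaling`, stub 3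
# `stub_typeII_transfer`: Seregin's Type II theorem transferred to axis points at the final time

Support file (theorems only, `--supports stmt-NavierStokesRegularity-15453`).

The stub is a pure transfer statement.  Its first hypothesis is the tree's named fact
`Seregin2020_axisymmetricSingularPoint_typeII` (G. Seregin, Anal. Math. Phys. 10 (2020), Paper 46
= arXiv:2006.04140, Thm 2.1: an axially symmetric suitable weak solution `(v, q)` of the
unit-viscosity system in the unit cylinder `Q = 𝒞 × ]-1, 0[` (`SereginSverak2009.parCyl 0 1`)
with `v ∈ L_{2,∞}(Q)`, `∇v ∈ L₂(Q)`, `q ∈ L_{3/2}(Q)` whose origin is a singular point has blow-up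
index `g(0) = ∞`; contrapositively, `…typeI_regular`: `g(0) < ∞` makes `v` essentially bounded
on some `Q_r(0)`).  GIVEN it, a suitable weak solution `(u, p)` (viscosity `ν > 0`) on the open
strip `(0, T) × ℝ³`, `u` smooth with axisymmetric slices, `p` with axisymmetric slices, local
energy classes reaching the final time on every `(t₁, T) × B_ρ(0)`, with
`limsup_{r → 0} C(r) < ∞` at an axis point `x₀`, `C(r) = r⁻² ∫_{Q_r(T, x₀)} |u|³` (`cknC`), is
bounded near `(T, x₀)` (`IsBoundedNearTop u T x₀`).

Proof (adapted from the landed twin `Registered.stub_axisBounded_of_localEnergy_origin`): with a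
scale `λ > 0`, `λ²/ν < T/2` (`Registered.exists_scale`) put `Φ(s, y) = (T + (λ²/ν) s, x₀ + λ y)`,
`v = (λ/ν) u ∘ Φ`, `q = (λ/ν)² p ∘ Φ` (`IsSuitableWeakSolutionOn.stRescale`: viscosity
`(λ/ν) ν / λ = 1`; `.of_le` to the unit cylinder, which `Φ` maps into
`(T - λ²/ν, T) × B(x₀, 2λ) ⊆ (T/2, T) × B(0, ρ)`); the three classes on the unit cylinder come
from the hypothesised ones by the change of variables (`ae_sliced_setLIntegral_ball_stRescale`,
`setLIntegral_frobeniusNormSq_stRescale` for the weak gradient `(λ²/ν) ∇u ∘ Φ` of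
`hasWeakSpatialGradientOn_of_contDiffOn` / `.stRescale`, `setLIntegral_enorm_rpow_stRescale`);
`x₀ = b e₃` is fixed by the (linear) rotations about the axis, so the rescaled slices stay
axisymmetric (`SereginSverak2009.isAxisymmetric_rescale`).  NEW: the scaled cubic quantity
transfers along the (anisotropic, `ν ≠ 1`) zoom — `Q_r(0) ⊆ Φ⁻¹(Q_{c r}(T, x₀))` for
`c = λ (1 + 1/√ν)` (time depth `(λ²/ν) r² ≤ c² r²`, radius `λ r ≤ c r`), whence
`C(r; v, 0) ≤ (λ/ν)³ (λ⁵/ν)⁻¹ c² · C(c r; u, (T, x₀))` (`setLIntegral_enorm_pow_stRescale`) and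
`limsup_{r→0} C(r; v, 0) < ∞`, so `g(0) ≤ limsup C < ∞` (`Seregin2020.blowupIndex_le_limsup_cknC`).
Seregin's theorem (`…typeI_regular`) gives `v ∈ L^∞(Q_r(0))`, which is transported back along
the measure-scaling bijection `Φ` to a bound of `u` on a backward neighbourhood of `(T, x₀)`
(`Registered.isBoundedNearTop_of_eLpNorm_rescaled_lt_top`).  References: G. Seregin, Anal. Math.
Phys. 10 (2020), Paper 46, Thm 2.1 and Def. 1.7 [Seregin2020]; G. Seregin, V. Šverák, Comm. PDE
34 (2009) = arXiv:0804.1803, §4 (the axis-centred rescaling before (p3)) [SereginSverak2009];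
L. Caffarelli, R. Kohn, L. Nirenberg, Comm. Pure Appl. Math. 35 (1982), §2 (scaling of `C(r)`)
[CaffarelliKohnNirenberg1982].
-/

noncomputable section

-- the summit and its single sub-problem share the name (CONVENTIONS §1), as in every Theorems file
set_option linter.dupNamespace false

open Set MeasureTheory Filter Topology Function Metric Module Literature.Analysis.FluidPDE
open scoped ENNReal NNReal

namespace Summit.NavierStokesRegularity.NavierStokesRegularity.Theorems.AxisymmetricKatoGlobal.EulerScaling

/-- Local notation for physical space `ℝ³`. -/
local notation "ℝ³" => EuclideanSpace ℝ (Fin 3)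

/-! ### The scaled cubic quantity under the anisotropic zoom -/

/-- **The zoom maps small standard cylinders into small physical cylinders**: for
`Φ(s, y) = (T + β s, x₀ + γ y)` with `γ ≤ c`, `β ≤ c²` one has `Q_r(0) ⊆ Φ⁻¹(Q_{c r}(T, x₀))`
(time depth `β r² ≤ (c r)²`, radius `γ r ≤ c r`). [folklore] -/
theorem parabolicCylinder_zero_subset_preimage_stAffine {β γ c : ℝ} (hβ : 0 < β) (hγ : 0 < γ)
    (hγc : γ ≤ c) (hβc : β ≤ c ^ 2) (T : ℝ) (x₀ : ℝ³) (r : ℝ) :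
    parabolicCylinder r (0 : ℝ × ℝ³) ⊆
      stAffine β γ T x₀ ⁻¹' parabolicCylinder (c * r) ((T, x₀) : ℝ × ℝ³) := by
  intro z hz
  rw [mem_parabolicCylinder] at hz
  obtain ⟨⟨hs1, hs2⟩, hy⟩ := hz
  change (0 : ℝ) - r ^ 2 < z.1 at hs1
  change z.1 < (0 : ℝ) at hs2
  change dist z.2 (0 : ℝ³) < r at hy
  rw [dist_zero_right] at hy
  have hr : 0 < r := (norm_nonneg _).trans_lt hy
  rw [mem_preimage, mem_parabolicCylinder, stAffine_fst, stAffine_snd]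
  refine ⟨⟨?_, ?_⟩, ?_⟩
  · show T - (c * r) ^ 2 < T + β * z.1
    have h1 : β * r ^ 2 ≤ (c * r) ^ 2 := by
      rw [mul_pow]; exact mul_le_mul_of_nonneg_right hβc (sq_nonneg r)
    nlinarith [mul_lt_mul_of_pos_left hs1 hβ]
  · show T + β * z.1 < T
    nlinarith [mul_neg_of_pos_of_neg hβ hs2]
  · show dist (x₀ + γ • z.2) x₀ < c * r
    rw [dist_eq_norm, add_sub_cancel_left, norm_smul, Real.norm_of_nonneg hγ.le]
    calc γ * ‖z.2‖ < γ * r := mul_lt_mul_of_pos_left hy hγ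
      _ ≤ c * r := mul_le_mul_of_nonneg_right hγc hr.le

/-- **Scaling of `C(r)` under the anisotropic zoom** (CKN 1982, §2: `C` is invariant under the
parabolic scaling; here `β ≠ γ²` is allowed at the price of the enlarged radius `c r`):
`C(r; α u ∘ Φ, 0) ≤ |α|³ (β γ³)⁻¹ c² · C(c r; u, (T, x₀))`.
[cite: CaffarelliKohnNirenberg1982, §2] -/
theorem cknC_zero_rescale_le {β γ c : ℝ} (hβ : 0 < β) (hγ : 0 < γ) (hγc : γ ≤ c)
    (hβc : β ≤ c ^ 2) (T : ℝ) (x₀ : ℝ³) (α : ℝ) (u : ℝ → ℝ³ → ℝ³) {r : ℝ} (hr : 0 < r) :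
    cknC r (0 : ℝ × ℝ³) (α • stPull β γ T x₀ u) ≤
      ‖α‖ₑ ^ 3 * ENNReal.ofReal (β * γ ^ 3)⁻¹ * ENNReal.ofReal c ^ 2 *
        cknC (c * r) ((T, x₀) : ℝ × ℝ³) u := by
  have hc : 0 < c := hγ.trans_le hγc
  set I : ℝ≥0∞ := ∫⁻ q in parabolicCylinder (c * r) ((T, x₀) : ℝ × ℝ³), ‖u q.1 q.2‖ₑ ^ (3 : ℕ)
    with hI
  set A : ℝ≥0∞ := ‖α‖ₑ ^ 3 * ENNReal.ofReal (β * γ ^ 3)⁻¹ with hA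
  have hR0 : ENNReal.ofReal r ^ 2 ≠ 0 := pow_ne_zero _ (ENNReal.ofReal_pos.2 hr).ne'
  have hRtop : ENNReal.ofReal r ^ 2 ≠ ∞ := ENNReal.pow_ne_top ENNReal.ofReal_ne_top
  have hCR0 : ENNReal.ofReal (c * r) ^ 2 ≠ 0 :=
    pow_ne_zero _ (ENNReal.ofReal_pos.2 (mul_pos hc hr)).ne'
  have hCRtop : ENNReal.ofReal (c * r) ^ 2 ≠ ∞ := ENNReal.pow_ne_top ENNReal.ofReal_ne_top
  have hCR : ENNReal.ofReal (c * r) ^ 2 = ENNReal.ofReal c ^ 2 * ENNReal.ofReal r ^ 2 := by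
    rw [ENNReal.ofReal_mul hc.le, mul_pow]
  -- change of variables on `Φ⁻¹(Q_{c r}(T, x₀)) ⊇ Q_r(0)`
  have h1 : ∫⁻ q in parabolicCylinder r (0 : ℝ × ℝ³),
      ‖(α • stPull β γ T x₀ u) q.1 q.2‖ₑ ^ (3 : ℕ) ≤ A * I := by
    calc ∫⁻ q in parabolicCylinder r (0 : ℝ × ℝ³), ‖(α • stPull β γ T x₀ u) q.1 q.2‖ₑ ^ (3 : ℕ)
        ≤ ∫⁻ q in stAffine β γ T x₀ ⁻¹' parabolicCylinder (c * r) ((T, x₀) : ℝ × ℝ³),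
            ‖(α • stPull β γ T x₀ u) q.1 q.2‖ₑ ^ (3 : ℕ) :=
          lintegral_mono_set
            (parabolicCylinder_zero_subset_preimage_stAffine hβ hγ hγc hβc T x₀ r)
      _ = A * I := by
          rw [setLIntegral_enorm_pow_stRescale hβ hγ T x₀ α u _ 3, finrank_euclideanSpace_fin]
  -- `∫_{Q_{c r}} |u|³ = (c r)² C(c r)`
  have hX : I = ENNReal.ofReal (c * r) ^ 2 * cknC (c * r) ((T, x₀) : ℝ × ℝ³) u := by
    unfold cknC
    rw [ENNReal.mul_inv_cancel_left hCR0 hCRtop]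
  unfold cknC
  calc (ENNReal.ofReal r ^ 2)⁻¹ *
        ∫⁻ q in parabolicCylinder r (0 : ℝ × ℝ³), ‖(α • stPull β γ T x₀ u) q.1 q.2‖ₑ ^ (3 : ℕ)
      ≤ (ENNReal.ofReal r ^ 2)⁻¹ * (A * I) := mul_le_mul_right h1 _
    _ = (ENNReal.ofReal r ^ 2)⁻¹ * (ENNReal.ofReal r ^ 2 *
          (A * ENNReal.ofReal c ^ 2 * cknC (c * r) ((T, x₀) : ℝ × ℝ³) u)) := by
        rw [hX, hCR]; ring
    _ = A * ENNReal.ofReal c ^ 2 * cknC (c * r) ((T, x₀) : ℝ × ℝ³) u :=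
        ENNReal.inv_mul_cancel_left hR0 hRtop

/-- **Finiteness of `limsup C` transfers along the zoom**: if `limsup_{r→0} C(r; u, (T, x₀)) < ∞`
then `limsup_{r→0} C(r; α u ∘ Φ, 0) < ∞` (eventual bound `C < M + 1` pulled back along
`r ↦ c r`, which preserves `𝓝[>] 0`, and the comparison `cknC_zero_rescale_le`). [folklore] -/
theorem limsup_cknC_zero_rescale_lt_top {β γ c : ℝ} (hβ : 0 < β) (hγ : 0 < γ) (hγc : γ ≤ c)
    (hβc : β ≤ c ^ 2) (T : ℝ) (x₀ : ℝ³) (α : ℝ) {u : ℝ → ℝ³ → ℝ³}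
    (h : limsup (fun r => cknC r ((T, x₀) : ℝ × ℝ³) u) (𝓝[>] 0) < ∞) :
    limsup (fun r => cknC r (0 : ℝ × ℝ³) (α • stPull β γ T x₀ u)) (𝓝[>] 0) < ∞ := by
  have hc : 0 < c := hγ.trans_le hγc
  set M : ℝ≥0∞ := limsup (fun r => cknC r ((T, x₀) : ℝ × ℝ³) u) (𝓝[>] 0) with hM
  have hM1 : M < M + 1 := ENNReal.lt_add_right h.ne one_ne_zero
  have hev : ∀ᶠ ρ in 𝓝[>] (0 : ℝ), cknC ρ ((T, x₀) : ℝ × ℝ³) u < M + 1 :=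
    eventually_lt_of_limsup_lt hM1
  have hev' : ∀ᶠ r in 𝓝[>] (0 : ℝ), cknC (c * r) ((T, x₀) : ℝ × ℝ³) u < M + 1 :=
    eventually_nhdsGT_zero_mul_left hc hev
  set K : ℝ≥0∞ := ‖α‖ₑ ^ 3 * ENNReal.ofReal (β * γ ^ 3)⁻¹ * ENNReal.ofReal c ^ 2 with hK
  have hKtop : K ≠ ∞ :=
    ENNReal.mul_ne_top (ENNReal.mul_ne_top (ENNReal.pow_ne_top enorm_ne_top)
      ENNReal.ofReal_ne_top) (ENNReal.pow_ne_top ENNReal.ofReal_ne_top)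
  have hbound : ∀ᶠ r in 𝓝[>] (0 : ℝ),
      cknC r (0 : ℝ × ℝ³) (α • stPull β γ T x₀ u) ≤ K * (M + 1) := by
    filter_upwards [hev', self_mem_nhdsWithin] with r hr hr0
    exact (cknC_zero_rescale_le hβ hγ hγc hβc T x₀ α u hr0).trans (mul_le_mul_right hr.le K)
  calc limsup (fun r => cknC r (0 : ℝ × ℝ³) (α • stPull β γ T x₀ u)) (𝓝[>] 0)
      ≤ K * (M + 1) := limsup_le_of_le (by isBoundedDefault) hbound
    _ < ∞ := ENNReal.mul_lt_top hKtop.lt_top (ENNReal.add_lt_top.2 ⟨h, ENNReal.one_lt_top⟩)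

/-! ### The stub -/

/-- **Stub 3 `stub_typeII_transfer` of the line `euler-scaling` of the crux
`AxisymmetricKatoGlobal`**: transfer of Seregin's Type II theorem (Anal. Math. Phys. 10 (2020),
Thm 2.1, taken as the first hypothesis = the tree's named fact
`Seregin2020_axisymmetricSingularPoint_typeII`) from (`ν = 1`, unit cylinder, origin) to axis
points `(T, x₀)` of a suitable weak solution on the strip `(0, T) × ℝ³` whose local energy classes
reach the final time — translation of `(T, b e₃)` to the origin, parabolic rescaling
(`Registered.exists_scale`), viscosity normalisation, change of variables for the three classes,
axisymmetry of the rescaled slices, transfer of `limsup C < ∞` along the anisotropic zoom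
(`limsup_cknC_zero_rescale_lt_top`, hence `g(0) < ∞`), Seregin's contrapositive
`…typeI_regular`, transport of the essential bound back to `u`; see the module docstring.
[cite: Seregin2020, Thm 2.1] -/
theorem stub_typeII_transfer :
    Seregin2020_axisymmetricSingularPoint_typeII →
    ∀ ν : ℝ, 0 < ν → ∀ T : ℝ, 0 < T → ∀ (u : ℝ → ℝ³ → ℝ³) (p : ℝ → ℝ³ → ℝ),
      ContDiffOn ℝ (⊤ : ℕ∞) (uncurry u) (Ioo 0 T ×ˢ univ) →
      (∀ t ∈ Ioo 0 T, IsAxisymmetric (u t)) →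
      (∀ t ∈ Ioo 0 T, IsAxisymmetricScalar (p t)) →
      IsSuitableWeakSolutionOn (slab ℝ³ (Ioo 0 T) isOpen_Ioo) ν 0 u p →
      (∀ t₁ ∈ Ioo 0 T, ∀ ρ : ℝ, 0 < ρ →
          (∃ C : ℝ≥0, ∀ t ∈ Ioo t₁ T, ∫⁻ x in ball (0 : ℝ³) ρ, ‖u t x‖ₑ ^ 2 ≤ C) ∧
          (∫⁻ z in Ioo t₁ T ×ˢ ball (0 : ℝ³) ρ,
              ENNReal.ofReal (frobeniusNormSq (fderiv ℝ (u z.1) z.2)) < ∞) ∧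
          (∫⁻ z in Ioo t₁ T ×ˢ ball (0 : ℝ³) ρ, ‖p z.1 z.2‖ₑ ^ (3 / 2 : ℝ) < ∞)) →
      ∀ x₀ : ℝ³, cylRadius x₀ = 0 →
        limsup (fun r => cknC r ((T, x₀) : ℝ × ℝ³) u) (𝓝[>] 0) < ∞ →
        IsBoundedNearTop u T x₀ := by
  -- adapted from `Registered.stub_axisBounded_of_localEnergy_origin`
  -- (Theorems/AxisymmetricExtremalityAxisymmetricKatoGlobalStubAxisBoundedOfLocalEnergyOrigin.lean)
  intro hSer ν hν T hT u p hsm hax hpax hsw hcls x₀ hx₀ hC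
  -- the axis point is `b e₃`
  obtain ⟨b, rfl⟩ : ∃ b : ℝ, x₀ = b • eZ := ⟨x₀ 2, Registered.eq_smul_eZ_of_cylRadius_eq_zero hx₀⟩
  -- an intermediate time and the scale
  obtain ⟨t₀, ht₀⟩ : ∃ t₀, t₀ ∈ Ioo 0 T := ⟨T / 2, by linarith, by linarith⟩
  obtain ⟨l, hl, -, -, hlT⟩ := Registered.exists_scale hν ht₀.2 one_pos
  set α : ℝ := l / ν with hαdef
  set β : ℝ := l ^ 2 / ν with hβdef
  have hα : 0 < α := by positivity
  have hβ : 0 < β := by positivity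
  have hβeq : β = α * l := by rw [hβdef, hαdef]; field_simp
  have hβt₀ : t₀ < T - β := by rw [hβdef]; linarith
  -- the rescaled pair
  set v : ℝ → ℝ³ → ℝ³ := α • stPull β l T (b • eZ) u with hv
  set q : ℝ → ℝ³ → ℝ := α ^ 2 • stPull β l T (b • eZ) p with hq
  have hvs : ∀ s, v s = fun y => α • u (T + β * s) (b • eZ + l • y) := fun s => by
    funext y; rfl
  -- the rescaled times lie in `(T - β, T) ⊆ (t₀, T) ⊆ (0, T)`
  have htime : ∀ s ∈ Ioo (-1 : ℝ) 0, T + β * s ∈ Ioo t₀ T := fun s hs =>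
    ⟨by nlinarith [hs.1], by nlinarith [hs.2]⟩
  have htime0 : ∀ s ∈ Ioo (-1 : ℝ) 0, T + β * s ∈ Ioo 0 T := fun s hs =>
    ⟨ht₀.1.trans (htime s hs).1, (htime s hs).2⟩
  -- (0) the unit cylinder is mapped into the strip, and into the box `(T - β, T) × B(x₀, 2λ)`
  have hparsub := Registered.parCyl_zero_one_subset_preimage_stAffine hβ hl T (b • eZ)
  have hdom : SereginSverak2009.parCylOpens 0 1 ≤
      stPreimage β l T (b • eZ) (slab ℝ³ (Ioo 0 T) isOpen_Ioo) := fun z hz => by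
    have h := (mem_prod.1 (hparsub hz)).1
    rw [mem_stPreimage, mem_slab]
    exact ⟨by linarith [h.1, ht₀.1], h.2⟩
  -- the physical box lies in `(t₀, T) × B(0, ρ)`, where the classes are hypothesised
  set ρ : ℝ := ‖(b • eZ : ℝ³)‖ + 2 * l with hρ
  have hρpos : 0 < ρ := by positivity
  have hballρ : ball (b • eZ : ℝ³) (2 * l) ⊆ ball 0 ρ := by
    intro x hx
    rw [mem_ball, dist_eq_norm] at hx
    rw [mem_ball, dist_zero_right, hρ]
    linarith [norm_le_norm_add_norm_sub' x (b • eZ : ℝ³)]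
  have hPBsub : Ioo (T - β) T ×ˢ ball (b • eZ : ℝ³) (2 * l) ⊆ Ioo t₀ T ×ˢ ball 0 ρ :=
    prod_mono (Ioo_subset_Ioo_left hβt₀.le) hballρ
  obtain ⟨⟨CA, hCA⟩, hgradfin, hpresfin⟩ := hcls t₀ ht₀ ρ hρpos
  -- (1) the rescaled pair is a suitable weak solution of the unit-viscosity system on `Q(0, 1)`
  have hsuitv : IsSuitableWeakSolutionOn (SereginSverak2009.parCylOpens 0 1) 1 0 v q := by
    have h0 := hsw.stRescale hα hl hβeq T (b • eZ)
    have hvisc : α * ν / l = 1 := by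
      rw [hαdef, div_mul_cancel₀ l hν.ne', div_self hl.ne']
    have hforce : ((α ^ 2 * l) • stPull β l T (b • eZ) (0 : ℝ → ℝ³ → ℝ³)) = 0 := by
      funext s y; simp [stPull]
    rw [hvisc, hforce] at h0
    exact h0.of_le hdom
  -- (2) `v ∈ L_{2,∞}(Q)`
  have hA : ∃ C : ℝ≥0, ∀ᵐ s ∂(volume.restrict (Ioo (-1 : ℝ) 0)),
      ∫⁻ y in SereginSverak2009.spaceCyl 0 1, ‖v s y‖ₑ ^ 2 ≤ C := by
    have hphys : ∀ᵐ t ∂(volume.restrict (Ioo (T + β * (-1)) (T + β * 0))),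
        ∫⁻ x in ball (b • eZ : ℝ³) (2 * l), ‖u t x‖ₑ ^ 2 ≤ (CA : ℝ≥0∞) := by
      refine (ae_restrict_mem measurableSet_Ioo).mono fun t ht => ?_
      exact (lintegral_mono_set hballρ).trans (hCA t ⟨by linarith [ht.1], by linarith [ht.2]⟩)
    have h2 := ae_sliced_setLIntegral_ball_stRescale hβ hl T (b • eZ) (b • eZ) (2 * l) (-1) 0
      (fun t x => ‖u t x‖ₑ ^ 2) hphys
    have h2l : 2 * l / l = 2 := by rw [mul_div_assoc, div_self hl.ne', mul_one]
    rw [finrank_euclideanSpace_fin, sub_self, smul_zero, h2l] at h2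
    set C₁ : ℝ≥0∞ := ‖α‖ₑ ^ 2 * (ENNReal.ofReal (l ^ 3)⁻¹ * CA) with hC₁
    have hC₁top : C₁ ≠ ∞ :=
      ENNReal.mul_ne_top (by simp) (ENNReal.mul_ne_top ENNReal.ofReal_ne_top ENNReal.coe_ne_top)
    refine ⟨C₁.toNNReal, ?_⟩
    rw [ENNReal.coe_toNNReal hC₁top]
    filter_upwards [h2] with s hs
    have e : ∀ y : ℝ³, ‖v s y‖ₑ ^ 2 = ‖α‖ₑ ^ 2 * ‖u (T + β * s) (b • eZ + l • y)‖ₑ ^ 2 := by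
      intro y
      rw [hvs s]
      simp only [enorm_smul, mul_pow]
    simp only [e]
    rw [lintegral_const_mul' _ _ (by simp)]
    exact mul_le_mul' le_rfl
      ((lintegral_mono_set Registered.spaceCyl_zero_one_subset_ball).trans hs)
  -- (3) `∇v = (α λ) ∇u ∘ Φ ∈ L₂(Q)`
  set G : ℝ → ℝ³ → ℝ³ →L[ℝ] ℝ³ :=
    (α * l) • stPull β l T (b • eZ) (fun t x => fderiv ℝ (u t) x) with hG
  have hGu : HasWeakSpatialGradientOn (slab ℝ³ (Ioo 0 T) isOpen_Ioo) u
      fun t x => fderiv ℝ (u t) x :=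
    hasWeakSpatialGradientOn_of_contDiffOn isOpen_Ioo (by rw [coe_slab]) (hsm.of_le (by norm_cast))
  have hGv : HasWeakSpatialGradientOn (SereginSverak2009.parCylOpens 0 1) v G :=
    (hGu.stRescale α hβ hl T (b • eZ)).mono hdom
  have hGfin : ∫⁻ z in SereginSverak2009.parCyl 0 1,
      ENNReal.ofReal (frobeniusNormSq (G z.1 z.2)) < ∞ := by
    refine lt_of_le_of_lt (lintegral_mono_set hparsub) ?_
    rw [hG, setLIntegral_frobeniusNormSq_stRescale hβ hl T (b • eZ) (α * l),
      finrank_euclideanSpace_fin]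
    refine ENNReal.mul_lt_top (ENNReal.mul_lt_top ENNReal.ofReal_lt_top ENNReal.ofReal_lt_top) ?_
    exact lt_of_le_of_lt (lintegral_mono_set hPBsub) hgradfin
  -- (4) `q ∈ L_{3/2}(Q)`
  have hqfin : ∫⁻ z in SereginSverak2009.parCyl 0 1, ‖q z.1 z.2‖ₑ ^ (3 / 2 : ℝ) < ∞ := by
    refine lt_of_le_of_lt (lintegral_mono_set hparsub) ?_
    rw [hq, setLIntegral_enorm_rpow_stRescale hβ hl T (b • eZ) (α ^ 2) p _ (by norm_num),
      finrank_euclideanSpace_fin]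
    refine ENNReal.mul_lt_top (ENNReal.mul_lt_top
      (ENNReal.rpow_lt_top_of_nonneg (by norm_num) enorm_ne_top) ENNReal.ofReal_lt_top) ?_
    exact lt_of_le_of_lt (lintegral_mono_set hPBsub) hpresfin
  -- (5) axisymmetry of the rescaled slices (`b e₃` is fixed by the rotations, which are linear)
  have hvax : ∀ s ∈ Ioo (-1 : ℝ) 0, IsAxisymmetric (v s) := fun s hs => by
    rw [hvs s]; exact SereginSverak2009.isAxisymmetric_rescale (hax _ (htime0 s hs)) α b l
  have hqax : ∀ s ∈ Ioo (-1 : ℝ) 0, IsAxisymmetricScalar (q s) := by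
    intro s hs θ y
    show α ^ 2 • p (T + β * s) (b • eZ + l • rotZ θ y) = α ^ 2 • p (T + β * s) (b • eZ + l • y)
    rw [← SereginSverak2009.rotZ_smul_eZ_add_smul, hpax _ (htime0 s hs) θ]
  -- (6) the blow-up index of `v` at the origin is finite: `limsup C < ∞` transfers along the
  -- anisotropic zoom with the enlarged radius factor `c = λ (1 + 1/√ν)`
  set c : ℝ := l * (1 + (Real.sqrt ν)⁻¹) with hcdef
  have hsν : 0 ≤ (Real.sqrt ν)⁻¹ := by positivity
  have hlc : l ≤ c := by rw [hcdef]; nlinarith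
  have hβc : β ≤ c ^ 2 := by
    have h1 : β = (l * (Real.sqrt ν)⁻¹) ^ 2 := by
      rw [hβdef, mul_pow, inv_pow, Real.sq_sqrt hν.le, div_eq_mul_inv]
    rw [h1, hcdef]
    exact pow_le_pow_left₀ (by positivity) (mul_le_mul_of_nonneg_left (by linarith) hl.le) 2
  have hI : Seregin2020.blowupIndex 0 v G < ∞ :=
    (Seregin2020.blowupIndex_le_limsup_cknC 0 v G).trans_lt
      (limsup_cknC_zero_rescale_lt_top hβ hl hlc hβc T (b • eZ) α hC)
  -- (7) Seregin's theorem: `v` is essentially bounded near the vertex; transport back to `u`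
  obtain ⟨r, hr, hbd⟩ := hSer.typeI_regular hsuitv hA hGv hGfin hqfin hvax hqax hI
  exact Registered.isBoundedNearTop_of_eLpNorm_rescaled_lt_top hT hsm.continuousOn (b • eZ) hα hβ
    hl hr hbd

end Summit.NavierStokesRegularity.NavierStokesRegularity.Theorems.AxisymmetricKatoGlobal.EulerScaling

end
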